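import Summits.CriticalPhenomena.PercolationContinuityZ3.Theorems.PercNearOneGluingNoHeavyPcintKernZ5S4Defs
import HarnessLib

/-!
# PCINT lane, kernel check 1/2 of the B2r window certificate `d = 5`, memory 4 (3-step windows, 1000 codes): codes `0 ≤ c < 500`

Cell `prim-pcint`, seat `prim-pcint-2` (gen 2).  Collatz–Wielandt rows `10^5 · row ≤ 99999 · DEN · v` for the window codes in
`[0, 500)`, by `decide +kernel` in chunks of `100` codes (natural-number arithmetic only; `maxHeartbeats 0`).
Does NOT build on p205010.
-/

namespace Summit.CriticalPhenomena.PercolationContinuityZ3.Theorems.Pcint.Z5S4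

set_option maxHeartbeats 0 in
/-- Rows `0 ≤ c < 100` of the certificate hold. [folklore] -/
theorem chk_0_100 : chk 0 100 = true := by decide +kernel

set_option maxHeartbeats 0 in
/-- Rows `100 ≤ c < 200` of the certificate hold. [folklore] -/
theorem chk_100_200 : chk 100 200 = true := by decide +kernel

set_option maxHeartbeats 0 in
/-- Rows `200 ≤ c < 300` of the certificate hold. [folklore] -/
theorem chk_200_300 : chk 200 300 = true := by decide +kernel

set_option maxHeartbeats 0 in
/-- Rows `300 ≤ c < 400` of the certificate hold. [folklore] -/
theorem chk_300_400 : chk 300 400 = true := by decide +kernel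

set_option maxHeartbeats 0 in
/-- Rows `400 ≤ c < 500` of the certificate hold. [folklore] -/
theorem chk_400_500 : chk 400 500 = true := by decide +kernel

/-- Rows `0 ≤ c < 500` of the certificate hold. [folklore] -/
theorem chkFile_1 : chk 0 500 = true :=
  chk_split (chk_split (chk_split (chk_split chk_0_100 chk_100_200) chk_200_300) chk_300_400) chk_400_500

end Summit.CriticalPhenomena.PercolationContinuityZ3.Theorems.Pcint.Z5S4
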